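import Mathlib
import Summits.Ventures.PercRepro2.K5HyperCoeffs3B
import Summits.Ventures.PercRepro2.K5HyperTheorem3

/-!
# THE CRUX KERNEL'S STAR STATEMENTS AT THE COINCIDENCE MARKINGS AS PROFILE SUMS OF `K₃` ON `K₅`
(blind cell PercRepro2, typer-1 g11; mine-1 §23.12 at the three `MarksDistinct` markings — the dictionary between
`K5HyperCoeffs3B.lean` and the (TRI) kernel `CovForm.K3` at the marking `(0, 1, 2, 3, b)`, `b : Fin 5`)

`NOn3b b S₁ S₂ S₃ k = Σ_{prof x y w = k} K₃(x ∨ S₁, y ∨ S₂, w ∨ S₃)` is the hyperedge-augmented typed count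
(`typedCountHyper`) of the crux kernel at the marking `b` and the `K₅` profile `k`; `NOn3b_eq`: it is
`cPosOn3b b − cNegOn3b b` (`K5K3Tables.K3_apply b`).  With the placement sums `rsumT1`, …:

* **`M3b_real`**: `N(K₅ + D(1)) ≤ N(K₅ + D(1) + P(1))` at the marking `b` — `M-TRI ≥ 0`;
* **`TvT3b_real`**: `N(K₅ + T(1)) ≤ N(K₅ + △(1,1,1))` at the marking `b` — `TvT-TRI ≥ 0`;
* **`T13b_real`**, **`T23b_real`**: `0 ≤ N(K₅ + D(1))`, `0 ≤ N(K₅ + D(2))` at the marking `b` (p2's `K5StarCertTA/TB`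
  certificates have this shape: `CertLE (sumT1 (negOn3b b) D) (sumT1 (posOn3b b) D)`).

At `b = 4` everything is g10's (`NOn3b_four`).
-/

namespace Summit.Ventures.PercRepro2

open Hub

namespace K5

section Dictionary3B

variable {R : Type*} [Field R] [LinearOrder R] [IsStrictOrderedRing R]

/-- The masked profile sum of the crux kernel `K₃` at the marking `(0, 1, 2, 3, b)`. -/
noncomputable def NOn3b (b : Fin 5) (S₁ S₂ S₃ : Fin 10 → Bool) (k : Fin 10 → Fin 4) : R :=
  typedCountHyper Finset.univ (fun _ => false) (fun e => (k e : ℕ)) S₁ S₂ S₃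
    (CovForm.K3 (R := R) ends5 0 1 2 3 b)

omit [LinearOrder R] [IsStrictOrderedRing R] in
/-- At the distinct marking this is g10's `NOn3`. -/
theorem NOn3b_four : NOn3b (R := R) 4 = NOn3 := rfl

/-- `N(K₅ + D(1))` at the marking `b`. -/
noncomputable def NT13b (b : Fin 5) (D : Fin 10 → Bool) (k : Fin 10 → Fin 4) : R :=
  rsumT1 (fun S₁ S₂ S₃ => NOn3b b S₁ S₂ S₃ k) D

/-- `N(K₅ + D(2))` at the marking `b`. -/
noncomputable def NT23b (b : Fin 5) (D : Fin 10 → Bool) (k : Fin 10 → Fin 4) : R :=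
  rsumT2 (fun S₁ S₂ S₃ => NOn3b b S₁ S₂ S₃ k) D

/-- `N(K₅ + D(1) + P(1))` at the marking `b`. -/
noncomputable def NT1e13b (b : Fin 5) (D P : Fin 10 → Bool) (k : Fin 10 → Fin 4) : R :=
  rsumT1e1 (fun S₁ S₂ S₃ => NOn3b b S₁ S₂ S₃ k) D P

/-- `N(K₅ + P₁(1) + P₂(1) + P₃(1))` at the marking `b`. -/
noncomputable def NE33b (b : Fin 5) (P₁ P₂ P₃ : Fin 10 → Bool) (k : Fin 10 → Fin 4) : R :=
  rsumE3 (fun S₁ S₂ S₃ => NOn3b b S₁ S₂ S₃ k) P₁ P₂ P₃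

set_option maxHeartbeats 4000000 in
omit [LinearOrder R] [IsStrictOrderedRing R] in
/-- **The dictionary at the marking `b`**: the masked profile sum of `K₃` is `cPosOn3b b − cNegOn3b b`. -/
theorem NOn3b_eq (b : Fin 5) (S₁ S₂ S₃ : Fin 10 → Bool) (k : Fin 10 → Fin 4) :
    NOn3b (R := R) b S₁ S₂ S₃ k =
      ((cPosOn3b (b : ℕ) S₁ S₂ S₃ k : ℕ) : R) - ((cNegOn3b (b : ℕ) S₁ S₂ S₃ k : ℕ) : R) := by
  unfold NOn3b typedCountHyper
  have hK : (fun x y w => CovForm.K3 (R := R) ends5 0 1 2 3 b (orOn S₁ x) (orOn S₂ y) (orOn S₃ w)) =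
      fun x y w =>
        (indR (fun ω => tPD (orOn S₁ ω)) x * indR (fun ω => tQ (orOn S₂ ω)) y * indR (fun ω => t4p b (orOn S₃ ω)) w +
          indR (fun ω => tQ (orOn S₁ ω)) x * indR (fun ω => tPDoU (orOn S₂ ω)) y * indR (fun ω => t5p b (orOn S₃ ω)) w +
          indR (fun ω => tPD (orOn S₁ ω)) x * indR (fun ω => tQ (orOn S₂ ω)) y * indR (fun ω => t6m b (orOn S₃ ω)) w +
          indR (fun ω => tPD (orOn S₁ ω)) x * indR (fun ω => t7p b (orOn S₂ ω)) y * indR (fun ω => t7m 0 (orOn S₃ ω)) w +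
          indR (fun ω => tPD (orOn S₁ ω)) x * indR (fun ω => t7m b (orOn S₂ ω)) y * indR (fun ω => t7p 0 (orOn S₃ ω)) w +
          indR (fun ω => tPDoU (orOn S₁ ω)) x * indR (fun ω => t7p b (orOn S₂ ω)) y * indR (fun ω => t7m 3 (orOn S₃ ω)) w +
          indR (fun ω => tPDoU (orOn S₁ ω)) x * indR (fun ω => t7m b (orOn S₂ ω)) y * indR (fun ω => t7p 3 (orOn S₃ ω)) w +
          indR (fun ω => tPD (orOn S₁ ω)) x * indR (fun ω => t7p b (orOn S₂ ω)) y * indR (fun ω => t10p (orOn S₃ ω)) w +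
          indR (fun ω => tPD (orOn S₁ ω)) x * indR (fun ω => t7m b (orOn S₂ ω)) y * indR (fun ω => t10m (orOn S₃ ω)) w +
          indR (fun ω => tQ (orOn S₁ ω)) x * indR (fun ω => t12 b (orOn S₂ ω)) y * indR (fun ω => tPDoU (orOn S₃ ω)) w) -
        (indR (fun ω => tPD (orOn S₁ ω)) x * indR (fun ω => tQ (orOn S₂ ω)) y * indR (fun ω => t4m b (orOn S₃ ω)) w +
          indR (fun ω => tQ (orOn S₁ ω)) x * indR (fun ω => tPDoU (orOn S₂ ω)) y * indR (fun ω => t5m b (orOn S₃ ω)) w +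
          indR (fun ω => tPD (orOn S₁ ω)) x * indR (fun ω => tQ (orOn S₂ ω)) y * indR (fun ω => t6p b (orOn S₃ ω)) w +
          indR (fun ω => tPD (orOn S₁ ω)) x * indR (fun ω => t7p b (orOn S₂ ω)) y * indR (fun ω => t7p 0 (orOn S₃ ω)) w +
          indR (fun ω => tPD (orOn S₁ ω)) x * indR (fun ω => t7m b (orOn S₂ ω)) y * indR (fun ω => t7m 0 (orOn S₃ ω)) w +
          indR (fun ω => tPDoU (orOn S₁ ω)) x * indR (fun ω => t7p b (orOn S₂ ω)) y * indR (fun ω => t7p 3 (orOn S₃ ω)) w +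
          indR (fun ω => tPDoU (orOn S₁ ω)) x * indR (fun ω => t7m b (orOn S₂ ω)) y * indR (fun ω => t7m 3 (orOn S₃ ω)) w +
          indR (fun ω => tPD (orOn S₁ ω)) x * indR (fun ω => t7p b (orOn S₂ ω)) y * indR (fun ω => t10m (orOn S₃ ω)) w +
          indR (fun ω => tPD (orOn S₁ ω)) x * indR (fun ω => t7m b (orOn S₂ ω)) y * indR (fun ω => t10p (orOn S₃ ω)) w +
          indR (fun ω => tPD (orOn S₁ ω)) x * indR (fun ω => tQ (orOn S₂ ω)) y * indR (fun ω => t11 b (orOn S₃ ω)) w) := by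
    funext x y w
    rw [K3_apply b]
    simp only [indR]
  rw [hK, typedCount_sub]
  simp only [typedCount_add, typedCount_tables Finset.univ (fun _ => false) (fun e => (k e : ℕ)) k (profile_univ k)]
  unfold cPosOn3b cNegOn3b cOn
  push_cast
  ring

omit [LinearOrder R] [IsStrictOrderedRing R] in
/-- `N(K₅ + D(1)) = csumT1 (cPosOn3b b) − csumT1 (cNegOn3b b)`. -/
lemma NT13b_eq (b : Fin 5) (D : Fin 10 → Bool) (k : Fin 10 → Fin 4) :
    NT13b (R := R) b D k = ((csumT1 (cPosOn3b b) D k : ℕ) : R) - ((csumT1 (cNegOn3b b) D k : ℕ) : R) := by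
  unfold NT13b rsumT1 csumT1
  simp only [NOn3b_eq]
  push_cast
  ring

omit [LinearOrder R] [IsStrictOrderedRing R] in
/-- `N(K₅ + D(2)) = csumT2 (cPosOn3b b) − csumT2 (cNegOn3b b)`. -/
lemma NT23b_eq (b : Fin 5) (D : Fin 10 → Bool) (k : Fin 10 → Fin 4) :
    NT23b (R := R) b D k = ((csumT2 (cPosOn3b b) D k : ℕ) : R) - ((csumT2 (cNegOn3b b) D k : ℕ) : R) := by
  unfold NT23b rsumT2 csumT2
  simp only [NOn3b_eq]
  push_cast
  ring

omit [LinearOrder R] [IsStrictOrderedRing R] in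
/-- `N(K₅ + D(1) + P(1)) = csumT1e1 (cPosOn3b b) − csumT1e1 (cNegOn3b b)`. -/
lemma NT1e13b_eq (b : Fin 5) (D P : Fin 10 → Bool) (k : Fin 10 → Fin 4) :
    NT1e13b (R := R) b D P k =
      ((csumT1e1 (cPosOn3b b) D P k : ℕ) : R) - ((csumT1e1 (cNegOn3b b) D P k : ℕ) : R) := by
  unfold NT1e13b rsumT1e1 csumT1e1
  simp only [NOn3b_eq]
  push_cast
  ring

omit [LinearOrder R] [IsStrictOrderedRing R] in
/-- `N(K₅ + P₁(1) + P₂(1) + P₃(1)) = csumE3 (cPosOn3b b) − csumE3 (cNegOn3b b)`. -/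
lemma NE33b_eq (b : Fin 5) (P₁ P₂ P₃ : Fin 10 → Bool) (k : Fin 10 → Fin 4) :
    NE33b (R := R) b P₁ P₂ P₃ k =
      ((csumE3 (cPosOn3b b) P₁ P₂ P₃ k : ℕ) : R) - ((csumE3 (cNegOn3b b) P₁ P₂ P₃ k : ℕ) : R) := by
  unfold NE33b rsumE3 csumE3 csumE3a csumE3b csumE3c
  simp only [NOn3b_eq]
  push_cast
  ring

/-- **`M-TRI ≥ 0` at the marking `b`: `N(K₅ + D(1)) ≤ N(K₅ + D(1) + P(1))`** from the certificate. -/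
theorem M3b_real (b : Fin 5) (D P : Fin 10 → Bool) (hc : CertLE (kNegM3b b D P) (kPosM3b b D P))
    (k : Fin 10 → Fin 4) : NT13b (R := R) b D k ≤ NT1e13b (R := R) b D P k := by
  have h := cNegM3b_le_cPosM3b b D P hc k
  unfold cNegM3b cPosM3b at h
  rw [NT13b_eq, NT1e13b_eq, sub_le_sub_iff]
  exact_mod_cast (by omega :
    csumT1 (cPosOn3b b) D k + csumT1e1 (cNegOn3b b) D P k ≤
      csumT1e1 (cPosOn3b b) D P k + csumT1 (cNegOn3b b) D k)

/-- **`TvT-TRI ≥ 0` at the marking `b`: `N(K₅ + T(1)) ≤ N(K₅ + △(1,1,1))`** from the base-`2^25` certificate. -/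
theorem TvT3b_real (b : Fin 5) (x y z : ℕ) (hc : CertLE5 (kNegTvT35b b x y z) (kPosTvT35b b x y z))
    (k : Fin 10 → Fin 4) :
    NT13b (R := R) b (triMask x y z) k ≤ NE33b (R := R) b (pairMask x y) (pairMask x z) (pairMask y z) k := by
  have h := cNegTvT3b_le_cPosTvT3b b x y z hc k
  unfold cNegTvT3b cPosTvT3b at h
  rw [NT13b_eq, NE33b_eq, sub_le_sub_iff]
  exact_mod_cast (by omega :
    csumT1 (cPosOn3b b) (triMask x y z) k + csumE3 (cNegOn3b b) (pairMask x y) (pairMask x z) (pairMask y z) k ≤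
      csumE3 (cPosOn3b b) (pairMask x y) (pairMask x z) (pairMask y z) k + csumT1 (cNegOn3b b) (triMask x y z) k)

/-- **`0 ≤ N(K₅ + D(1))` at the marking `b`** from a certificate of p2's `K5StarCertTA/TB` shape. -/
theorem T13b_real (b : Fin 5) (D : Fin 10 → Bool) (hc : CertLE (sumT1 (negOn3b b) D) (sumT1 (posOn3b b) D))
    (k : Fin 10 → Fin 4) : 0 ≤ NT13b (R := R) b D k := by
  rw [NT13b_eq, sub_nonneg]
  exact_mod_cast le_of_certLE (csumT1 (cPosOn3b b) D) (csumT1 (cNegOn3b b) D)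
    (fun k => by rw [KB3_val]; have := csumT1_le (cPosOn3b b) (10 * 59049) (cPosOn3b_le b) D k; omega)
    (fun k => by rw [KB3_val]; have := csumT1_le (cNegOn3b b) (10 * 59049) (cNegOn3b_le b) D k; omega)
    (sumT1_eq (cPosOn3b b) (posOn3b b) (posOn3b_eq b) D) (sumT1_eq (cNegOn3b b) (negOn3b b) (negOn3b_eq b) D) hc k

/-- **`0 ≤ N(K₅ + D(2))` at the marking `b`** from a certificate of p2's `K5StarCertTA/TB` shape. -/
theorem T23b_real (b : Fin 5) (D : Fin 10 → Bool) (hc : CertLE (sumT2 (negOn3b b) D) (sumT2 (posOn3b b) D))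
    (k : Fin 10 → Fin 4) : 0 ≤ NT23b (R := R) b D k := by
  rw [NT23b_eq, sub_nonneg]
  exact_mod_cast le_of_certLE (csumT2 (cPosOn3b b) D) (csumT2 (cNegOn3b b) D)
    (fun k => by rw [KB3_val]; have := csumT2_le (cPosOn3b b) (10 * 59049) (cPosOn3b_le b) D k; omega)
    (fun k => by rw [KB3_val]; have := csumT2_le (cNegOn3b b) (10 * 59049) (cNegOn3b_le b) D k; omega)
    (sumT2_eq (cPosOn3b b) (posOn3b b) (posOn3b_eq b) D) (sumT2_eq (cNegOn3b b) (negOn3b b) (negOn3b_eq b) D) hc k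

end Dictionary3B

end K5

end Summit.Ventures.PercRepro2
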